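import Literature.NumberTheory.Sieve.LinearEquationsInPrimesWTrickMajorArc
import Literature.NumberTheory.Sieve.LinearEquationsInPrimesWTrickMinorArc
import Literature.NumberTheory.LFunctions.SiegelWalfisz
import HarnessLib

/-!
# `sup_α |∑_{n ≤ N} (Λ'_{b,W}(n) − 1) e(nα)| = o(N)` (Green–Tao 2010, Thm. 7.2 at `s = 1`)

Topic `Literature/NumberTheory/Sieve`. Everything in this file is PROVED (no named facts), and
the main result is UNCONDITIONAL:

* `WTrick.wtrick_expSum_estimate` — for every `ε > 0` there are `w₀, N₀` with
  `‖∑_{n ≤ N} (Λ'_{b,W}(n) − 1) e(nα)‖ ≤ ε N` for all `N ≥ N₀`, `w₀ ≤ w ≤ ½ log log N`,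
  `W = ∏_{p ≤ w} p`, `b ∈ [W]` coprime to `W`, and all real `α`.

This is the exponential-sum form of Green–Tao, *Linear equations in primes*, Ann. of Math. 171
(2010), Thm. 7.2 at level `s = 1` (`‖Λ'_{b,W} − 1‖_{U²[N]} = o(1)`), obtained, as GT2010 §12
indicates ("the case `s = 1` … can be obtained by the classical Hardy–Littlewood method"), by the
circle method:

* **major arcs** (`major_case`): `α = a/q + β`, `q ≤ L¹²`, `|β| N ≤ L¹²` (`L = log(WN+b)`) — the
  explicit estimate `WTrick.norm_sum_vonMangoldtW_sub_one_majorArc_le` of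
  `LinearEquationsInPrimesWTrickMajorArc.lean`, fed with the Siegel–Walfisz theorem of the tree
  (`Literature.NumberTheory.LFunctions.siegel_walfisz_holds`, packaged by
  `swBound_of_siegel_walfisz` with exponent `A₂ = 26`); the `W`-trick leaves the single
  `w`-dependent term `N/φ(q) ≤ N/w` (`le_totient_of_coprime_primorial`);
* **minor arcs** (`minor_case`): Dirichlet's approximation theorem (Mathlib's
  `Real.exists_rat_abs_sub_le_and_den_le`) at each frequency `(α + j)/W`, Vinogradov's estimate of
  the tree (`Literature.NumberTheory.Sieve.Vinogradov.vinogradov_primeExpSumLog_bound`, Nathanson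
  Thm. 8.5) and `WTrick.norm_sum_vonMangoldtW_mul_le` of `LinearEquationsInPrimesWTrickMinorArc.lean`,
  plus `‖∑_{n ≤ N} e(nα)‖ ≤ 1/(2‖α‖)`;
* the bookkeeping `W ≤ 4^w ≤ log N` (`primorial_le_log`), `N ≤ WN + b ≤ 2N log N`,
  `log N ≤ L ≤ 2 log N` (`size_facts`), and the eventual inequalities
  `K (log N)^p N^θ ≤ c N` (`eventually_mul_log_pow_mul_rpow_le`, from Mathlib's
  `isLittleO_log_rpow_rpow_atTop`); `w₀ = ⌈4/ε⌉ + 2`, `N₀` ineffective (Siegel).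

With the inverse theorem for `U²[N]` and the converse for the circle
(`LinearEquationsInPrimesCircleObstruction.lean`) this yields Thm. 7.2 at `s = 1` unconditionally.

## References

* [GreenTao2010] B. Green, T. Tao, *Linear equations in primes*, Ann. of Math. 171 (2010),
  1753–1850, Thm. 7.2, §12 (arXiv:math/0606088, pp. 17, 29–30).
* [Nathanson1996] M. B. Nathanson, *Additive Number Theory: The Classical Bases*, GTM 164
  (Springer 1996), Ch. 8 (Thm. 8.5; Lemmas 8.2–8.3).
-/

noncomputable section

open scoped FourierTransform
open Finset Filter

namespace Literature.NumberTheory.Sieve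

namespace WTrick

/-! ### Eventual inequalities -/

/-- `K (log x)^p x^θ ≤ c x` eventually, for `θ < 1` and `c > 0`. [folklore] -/
theorem eventually_mul_log_pow_mul_rpow_le (K : ℝ) (p : ℕ) {θ : ℝ} (hθ : θ < 1) {c : ℝ}
    (hc : 0 < c) : ∀ᶠ x : ℝ in atTop, K * Real.log x ^ p * x ^ θ ≤ c * x := by
  rcases le_or_gt K 0 with hK | hK
  · filter_upwards [eventually_ge_atTop 1] with x hx
    have h1 : K * Real.log x ^ p * x ^ θ ≤ 0 :=
      mul_nonpos_of_nonpos_of_nonneg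
        (mul_nonpos_of_nonpos_of_nonneg hK (pow_nonneg (Real.log_nonneg hx) _))
        (Real.rpow_nonneg (by linarith) _)
    have h2 : 0 ≤ c * x := by positivity
    linarith
  · have h := (isLittleO_log_rpow_rpow_atTop (p : ℝ) (by linarith : 0 < 1 - θ)).bound
      (div_pos hc hK)
    filter_upwards [h, eventually_ge_atTop 1] with x hx hx1
    have hx0 : 0 < x := by linarith
    rw [Real.norm_of_nonneg (Real.rpow_nonneg (Real.log_nonneg hx1) _),
      Real.norm_of_nonneg (Real.rpow_nonneg hx0.le _), Real.rpow_natCast] at hx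
    calc K * Real.log x ^ p * x ^ θ ≤ K * (c / K * x ^ (1 - θ)) * x ^ θ := by
          gcongr
      _ = c * (x ^ (1 - θ) * x ^ θ) := by field_simp
      _ = c * x := by rw [← Real.rpow_add hx0, sub_add_cancel, Real.rpow_one]

/-- Natural-number form: there is `N₀` beyond which `K (log N)^p N^θ ≤ c N`. [folklore] -/
theorem eventually_nat_mul_log_pow_mul_rpow_le (K : ℝ) (p : ℕ) {θ : ℝ} (hθ : θ < 1) {c : ℝ}
    (hc : 0 < c) : ∀ᶠ N : ℕ in atTop, K * Real.log N ^ p * (N : ℝ) ^ θ ≤ c * N :=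
  tendsto_natCast_atTop_atTop.eventually (eventually_mul_log_pow_mul_rpow_le K p hθ hc)

/-- `log N ≥ K` eventually. [folklore] -/
theorem eventually_nat_le_log (K : ℝ) : ∀ᶠ N : ℕ in atTop, K ≤ Real.log N :=
  tendsto_natCast_atTop_atTop.eventually (Real.tendsto_log_atTop.eventually_ge_atTop K)

/-! ### The size of `W = ∏_{p ≤ w} p` for `w ≤ ½ log log N` -/

/-- For `w ≤ ½ log log N` (and `N ≥ 3`), `W = primorial w ≤ 4^w ≤ 2^{log log N} ≤ log N`.
[cite: GreenTao2010, §5 (Important convention: `W ≤ log N`)] -/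
theorem primorial_le_log {w N : ℕ} (hN : (3 : ℝ) ≤ N) (hw : (w : ℝ) ≤ Real.log (Real.log N) / 2) :
    ((primorial w : ℕ) : ℝ) ≤ Real.log N := by
  have hN0 : (0 : ℝ) < N := by linarith
  have hlogN : 1 < Real.log N := by
    rw [Real.lt_log_iff_exp_lt hN0]
    exact lt_of_lt_of_le (Real.exp_one_lt_d9.trans (by norm_num)) hN
  have hll : 0 ≤ Real.log (Real.log N) := Real.log_nonneg hlogN.le
  have h1 : ((primorial w : ℕ) : ℝ) ≤ (4 : ℝ) ^ w := by exact_mod_cast primorial_le_four_pow w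
  have h2 : (4 : ℝ) ^ w = (2 : ℝ) ^ ((2 * w : ℕ) : ℝ) := by
    rw [Real.rpow_natCast, pow_mul]; norm_num
  have h3 : (2 : ℝ) ^ ((2 * w : ℕ) : ℝ) ≤ (2 : ℝ) ^ Real.log (Real.log N) := by
    refine Real.rpow_le_rpow_of_exponent_le (by norm_num) ?_
    push_cast; linarith
  have h4 : (2 : ℝ) ^ Real.log (Real.log N) ≤ Real.log N := by
    rw [Real.rpow_def_of_pos (by norm_num : (0 : ℝ) < 2)]
    calc Real.exp (Real.log 2 * Real.log (Real.log N))
        ≤ Real.exp (1 * Real.log (Real.log N)) := by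
          gcongr
          · linarith [Real.log_two_lt_d9]
      _ = Real.log N := by rw [one_mul, Real.exp_log (by linarith)]
  linarith

/-- `2 log x ≤ x` for `x ≥ 16` (crude: `log x ≤ 2√x`). [folklore] -/
theorem two_mul_log_le {x : ℝ} (hx : 16 ≤ x) : 2 * Real.log x ≤ x := by
  have hx0 : 0 ≤ x := by linarith
  have h := Real.log_le_rpow_div hx0 (by norm_num : (0 : ℝ) < 1 / 2)
  have hs : x ^ (1 / 2 : ℝ) = Real.sqrt x := (Real.sqrt_eq_rpow x).symm
  rw [hs] at h
  have h4 : 4 ≤ Real.sqrt x := by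
    rw [show (4 : ℝ) = Real.sqrt 16 by
      rw [show (16 : ℝ) = 4 ^ 2 by norm_num, Real.sqrt_sq (by norm_num)]]
    exact Real.sqrt_le_sqrt hx
  have hsq : Real.sqrt x * Real.sqrt x = x := Real.mul_self_sqrt hx0
  have : Real.log x ≤ 2 * Real.sqrt x := by
    have := h; rw [div_eq_mul_inv] at this; linarith
  nlinarith

/-! ### Numeric bounds: major arcs -/

/-- The crude polylogarithmic bookkeeping on a major arc. With `1 ≤ LN ≤ L ≤ 2 LN`,
`1 ≤ X ≤ 2 N LN`, `1 ≤ q ≤ L¹²`, `0 ≤ T ≤ L¹²`, `0 ≤ ℓ ≤ L¹³`: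
`q (7√X + C₂ 2²⁶ X/L²⁶ + 2√X L + ℓ + 2q + 1)(1 + 2πT) + q²(1 + 2πT) ≤ 2³⁰ C₂ N/LN + 2⁴⁵ √N LN³⁸`.
[folklore] -/
theorem major_numeric {C₂ X L LN N q T ℓ : ℝ} (hC₂ : 0 ≤ C₂) (hLN : 1 ≤ LN) (hLNL : LN ≤ L)
    (hL2 : L ≤ 2 * LN) (hX1 : 1 ≤ X) (hXN : X ≤ 2 * N * LN) (hN : 1 ≤ N) (hq1 : 1 ≤ q)
    (hqL : q ≤ L ^ 12) (hT0 : 0 ≤ T) (hT : T ≤ L ^ 12) (hℓ0 : 0 ≤ ℓ) (hℓ : ℓ ≤ L ^ 13) :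
    q * (7 * Real.sqrt X + C₂ * 2 ^ 26 * X / L ^ 26 + 2 * Real.sqrt X * L + ℓ + 2 * q + 1) *
        (1 + 2 * Real.pi * T) + q ^ 2 * (1 + 2 * Real.pi * T) ≤
      2 ^ 30 * C₂ * N / LN + 2 ^ 45 * Real.sqrt N * LN ^ 38 := by
  have hL1 : 1 ≤ L := hLN.trans hLNL
  have hL0 : 0 < L := by linarith
  have hLN0 : 0 < LN := by linarith
  set s := Real.sqrt X with hs
  have hs1 : 1 ≤ s := Real.one_le_sqrt.2 hX1
  have hs0 : 0 ≤ s := by linarith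
  have hL12 : (1 : ℝ) ≤ L ^ 12 := one_le_pow₀ hL1
  have hL13 : (1 : ℝ) ≤ L ^ 13 := one_le_pow₀ hL1
  have hq0 : 0 ≤ q := by linarith
  -- `1 + 2πT ≤ 8 L¹²`
  have hP : 1 + 2 * Real.pi * T ≤ 8 * L ^ 12 := by
    have hπ : 2 * Real.pi ≤ 7 := by linarith [Real.pi_lt_d2]
    nlinarith
  have hP0 : 0 ≤ 1 + 2 * Real.pi * T := by positivity
  -- `Mq ≤ C₂ 2²⁶ X/L²⁶ + 13 s L¹³`
  have hM0 : 0 ≤ 7 * s + C₂ * 2 ^ 26 * X / L ^ 26 + 2 * s * L + ℓ + 2 * q + 1 := by positivity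
  have hM : 7 * s + C₂ * 2 ^ 26 * X / L ^ 26 + 2 * s * L + ℓ + 2 * q + 1 ≤
      C₂ * 2 ^ 26 * X / L ^ 26 + 13 * (s * L ^ 13) := by
    have e0 : 1 ≤ s * L ^ 13 := one_le_mul_of_one_le_of_one_le hs1 hL13
    have e1 : 7 * s ≤ 7 * (s * L ^ 13) := by nlinarith
    have e2 : 2 * s * L ≤ 2 * (s * L ^ 13) := by
      have : L ≤ L ^ 13 := le_self_pow₀ hL1 (by norm_num)
      nlinarith
    have e3 : ℓ ≤ s * L ^ 13 := hℓ.trans (le_mul_of_one_le_left (by positivity) hs1)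
    have e4 : 2 * q ≤ 2 * (s * L ^ 13) := by
      have : L ^ 12 ≤ L ^ 13 := pow_le_pow_right₀ hL1 (by norm_num)
      nlinarith
    linarith
  -- the two pieces
  have hS1 : q * (7 * s + C₂ * 2 ^ 26 * X / L ^ 26 + 2 * s * L + ℓ + 2 * q + 1) *
      (1 + 2 * Real.pi * T) ≤ L ^ 12 * (C₂ * 2 ^ 26 * X / L ^ 26 + 13 * (s * L ^ 13)) * (8 * L ^ 12) :=
    mul_le_mul (mul_le_mul hqL hM hM0 (by positivity)) hP hP0 (by positivity)
  have hS1' : L ^ 12 * (C₂ * 2 ^ 26 * X / L ^ 26 + 13 * (s * L ^ 13)) * (8 * L ^ 12) =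
      8 * C₂ * 2 ^ 26 * X / L ^ 2 + 104 * s * L ^ 37 := by
    field_simp; ring
  have hS2 : q ^ 2 * (1 + 2 * Real.pi * T) ≤ (L ^ 12) ^ 2 * (8 * L ^ 12) :=
    mul_le_mul (pow_le_pow_left₀ hq0 hqL 2) hP hP0 (by positivity)
  have hS2' : (L ^ 12) ^ 2 * (8 * L ^ 12) = 8 * L ^ 36 := by ring
  have hS2'' : 8 * L ^ 36 ≤ 8 * (s * L ^ 37) := by
    have : L ^ 36 ≤ L ^ 37 := pow_le_pow_right₀ hL1 (by norm_num)
    have : L ^ 37 ≤ s * L ^ 37 := le_mul_of_one_le_left (by positivity) hs1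
    linarith
  -- conversion to `N`, `LN`
  have hXL : X / L ^ 2 ≤ 2 * N / LN := by
    have h1 : X / L ^ 2 ≤ X / LN ^ 2 := by
      apply div_le_div_of_nonneg_left (by linarith) (by positivity)
      exact pow_le_pow_left₀ hLN0.le hLNL 2
    have h2 : X / LN ^ 2 ≤ 2 * N * LN / LN ^ 2 := div_le_div_of_nonneg_right hXN (by positivity)
    have h3 : 2 * N * LN / LN ^ 2 = 2 * N / LN := by field_simp
    linarith
  have hsN : s ≤ 2 * Real.sqrt N * LN := by
    rw [hs, Real.sqrt_le_iff]
    refine ⟨by positivity, ?_⟩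
    have : (2 * Real.sqrt N * LN) ^ 2 = 4 * N * LN ^ 2 := by
      rw [mul_pow, mul_pow, Real.sq_sqrt (by linarith)]; ring
    rw [this]; nlinarith
  have hL37 : L ^ 37 ≤ 2 ^ 37 * LN ^ 37 := by
    calc L ^ 37 ≤ (2 * LN) ^ 37 := pow_le_pow_left₀ hL0.le hL2 37
      _ = 2 ^ 37 * LN ^ 37 := by rw [mul_pow]
  have hsL : s * L ^ 37 ≤ 2 ^ 38 * Real.sqrt N * LN ^ 38 := by
    calc s * L ^ 37 ≤ (2 * Real.sqrt N * LN) * (2 ^ 37 * LN ^ 37) :=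
          mul_le_mul hsN hL37 (by positivity) (by positivity)
      _ = 2 ^ 38 * Real.sqrt N * LN ^ 38 := by ring
  have hsqN : 0 ≤ Real.sqrt N := Real.sqrt_nonneg N
  calc q * (7 * s + C₂ * 2 ^ 26 * X / L ^ 26 + 2 * s * L + ℓ + 2 * q + 1) * (1 + 2 * Real.pi * T) +
        q ^ 2 * (1 + 2 * Real.pi * T)
      ≤ (8 * C₂ * 2 ^ 26 * X / L ^ 2 + 104 * s * L ^ 37) + 8 * (s * L ^ 37) := by
        refine add_le_add (hS1.trans (le_of_eq hS1')) (hS2.trans ?_)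
        rw [hS2']; exact hS2''
    _ = 8 * C₂ * 2 ^ 26 * (X / L ^ 2) + 112 * (s * L ^ 37) := by ring
    _ ≤ 8 * C₂ * 2 ^ 26 * (2 * N / LN) + 112 * (2 ^ 38 * Real.sqrt N * LN ^ 38) := by gcongr
    _ = 2 ^ 30 * C₂ * N / LN + 112 * 2 ^ 38 * Real.sqrt N * LN ^ 38 := by ring
    _ ≤ 2 ^ 30 * C₂ * N / LN + 2 ^ 45 * Real.sqrt N * LN ^ 38 := by
        have : 0 ≤ Real.sqrt N * LN ^ 38 := by positivity
        nlinarith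

/-! ### Numeric bounds: minor arcs -/

/-- The crude bookkeeping on a minor arc: with `1 ≤ LN ≤ L ≤ 2LN`, `1 ≤ X ≤ 2 N LN`, `0 ≤ b' ≤ LN`:
`C (X/L⁶ + X^{4/5} + X/L⁶) L⁴ + (log 4) b' ≤ 4 C N/LN + (32 C + 2) N^{4/5} LN⁵`. [folklore] -/
theorem minor_numeric {C X L LN N b' : ℝ} (hC : 0 ≤ C) (hLN : 1 ≤ LN) (hLNL : LN ≤ L)
    (hL2 : L ≤ 2 * LN) (hX0 : 0 ≤ X) (hXN : X ≤ 2 * N * LN) (hN : 1 ≤ N) (hb0 : 0 ≤ b')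
    (hb : b' ≤ LN) :
    C * (X / L ^ 6 + X ^ (4 / 5 : ℝ) + X / L ^ 6) * L ^ 4 + Real.log 4 * b' ≤
      4 * C * N / LN + (32 * C + 2) * (N : ℝ) ^ (4 / 5 : ℝ) * LN ^ 5 := by
  have hL1 : 1 ≤ L := hLN.trans hLNL
  have hL0 : 0 < L := by linarith
  have hLN0 : 0 < LN := by linarith
  have hN0 : 0 ≤ N := by linarith
  -- `2 (X/L⁶) L⁴ = 2X/L² ≤ 4N/LN`
  have hXL : X / L ^ 2 ≤ 2 * N / LN := by
    have h1 : X / L ^ 2 ≤ X / LN ^ 2 := by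
      apply div_le_div_of_nonneg_left hX0 (by positivity)
      exact pow_le_pow_left₀ hLN0.le hLNL 2
    have h2 : X / LN ^ 2 ≤ 2 * N * LN / LN ^ 2 := div_le_div_of_nonneg_right hXN (by positivity)
    have h3 : 2 * N * LN / LN ^ 2 = 2 * N / LN := by field_simp
    linarith
  have hA : C * (X / L ^ 6 + X / L ^ 6) * L ^ 4 = 2 * C * (X / L ^ 2) := by
    field_simp; ring
  -- `X^{4/5} ≤ 2 N^{4/5} LN`
  have hX45 : X ^ (4 / 5 : ℝ) ≤ 2 * (N : ℝ) ^ (4 / 5 : ℝ) * LN := by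
    have h1 : X ^ (4 / 5 : ℝ) ≤ (2 * N * LN) ^ (4 / 5 : ℝ) :=
      Real.rpow_le_rpow hX0 hXN (by norm_num)
    have h2 : (2 * N * LN) ^ (4 / 5 : ℝ) = (N : ℝ) ^ (4 / 5 : ℝ) * (2 * LN) ^ (4 / 5 : ℝ) := by
      rw [show 2 * N * LN = N * (2 * LN) by ring, Real.mul_rpow hN0 (by positivity)]
    have h3 : (2 * LN) ^ (4 / 5 : ℝ) ≤ 2 * LN := by
      have h21 : (1 : ℝ) ≤ 2 * LN := by linarith
      calc (2 * LN) ^ (4 / 5 : ℝ) ≤ (2 * LN) ^ (1 : ℝ) :=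
            Real.rpow_le_rpow_of_exponent_le h21 (by norm_num)
        _ = 2 * LN := Real.rpow_one _
    have h4 : 0 ≤ (N : ℝ) ^ (4 / 5 : ℝ) := Real.rpow_nonneg hN0 _
    calc X ^ (4 / 5 : ℝ) ≤ (N : ℝ) ^ (4 / 5 : ℝ) * (2 * LN) ^ (4 / 5 : ℝ) := h1.trans (le_of_eq h2)
      _ ≤ (N : ℝ) ^ (4 / 5 : ℝ) * (2 * LN) := by gcongr
      _ = 2 * (N : ℝ) ^ (4 / 5 : ℝ) * LN := by ring
  have hL4 : L ^ 4 ≤ 16 * LN ^ 4 := by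
    calc L ^ 4 ≤ (2 * LN) ^ 4 := pow_le_pow_left₀ hL0.le hL2 4
      _ = 16 * LN ^ 4 := by rw [mul_pow]; norm_num
  have hN45 : 1 ≤ (N : ℝ) ^ (4 / 5 : ℝ) := Real.one_le_rpow hN (by norm_num)
  have hB : C * X ^ (4 / 5 : ℝ) * L ^ 4 ≤ 32 * C * (N : ℝ) ^ (4 / 5 : ℝ) * LN ^ 5 := by
    calc C * X ^ (4 / 5 : ℝ) * L ^ 4 ≤ C * (2 * (N : ℝ) ^ (4 / 5 : ℝ) * LN) * (16 * LN ^ 4) := by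
          gcongr
      _ = 32 * C * (N : ℝ) ^ (4 / 5 : ℝ) * LN ^ 5 := by ring
  have hlog4 : Real.log 4 < 2 := by
    have : Real.log 4 = 2 * Real.log 2 := by
      rw [show (4 : ℝ) = 2 ^ 2 by norm_num, Real.log_pow]; norm_num
    rw [this]; linarith [Real.log_two_lt_d9]
  have hD : Real.log 4 * b' ≤ 2 * (N : ℝ) ^ (4 / 5 : ℝ) * LN ^ 5 := by
    have h1 : Real.log 4 * b' ≤ 2 * LN := by
      have : 0 ≤ Real.log 4 := Real.log_nonneg (by norm_num)
      nlinarith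
    have h2 : LN ≤ LN ^ 5 := le_self_pow₀ hLN (by norm_num)
    have h3 : LN ^ 5 ≤ (N : ℝ) ^ (4 / 5 : ℝ) * LN ^ 5 := le_mul_of_one_le_left (by positivity) hN45
    nlinarith
  calc C * (X / L ^ 6 + X ^ (4 / 5 : ℝ) + X / L ^ 6) * L ^ 4 + Real.log 4 * b'
      = C * (X / L ^ 6 + X / L ^ 6) * L ^ 4 + C * X ^ (4 / 5 : ℝ) * L ^ 4 + Real.log 4 * b' := by ring
    _ ≤ 2 * C * (2 * N / LN) + 32 * C * (N : ℝ) ^ (4 / 5 : ℝ) * LN ^ 5 +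
          2 * (N : ℝ) ^ (4 / 5 : ℝ) * LN ^ 5 := by
        rw [hA]
        have : 2 * C * (X / L ^ 2) ≤ 2 * C * (2 * N / LN) := by gcongr
        linarith
    _ = 4 * C * N / LN + (32 * C + 2) * (N : ℝ) ^ (4 / 5 : ℝ) * LN ^ 5 := by ring



/-! ### Common size facts for `X = W N + b` -/

/-- From `4 ≤ log N`: `16 ≤ N` (indeed `N ≥ e⁴ > 53`). [folklore] -/
theorem sixteen_le_of_log {N : ℕ} (hN4 : 4 ≤ Real.log N) : (16 : ℝ) ≤ N := by
  have hN0 : (0 : ℝ) < N := by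
    rcases Nat.eq_zero_or_pos N with h | h
    · subst h; simp at hN4; linarith
    · exact_mod_cast h
  have h1 : Real.exp 4 ≤ N := (Real.le_log_iff_exp_le hN0).1 hN4
  have h2 : (16 : ℝ) ≤ Real.exp 4 := by
    have : Real.exp 4 = Real.exp 1 ^ 4 := by rw [Real.exp_one_pow]; norm_num
    rw [this]
    have h27 : (2.7 : ℝ) ≤ Real.exp 1 := by linarith [Real.exp_one_gt_d9]
    calc (16 : ℝ) ≤ 2.7 ^ 4 := by norm_num
      _ ≤ Real.exp 1 ^ 4 := pow_le_pow_left₀ (by norm_num) h27 4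
  linarith

/-- The basic comparisons between `N`, `X = WN + b`, `LN = log N` and `L = log X`, for
`4 ≤ log N`, `1 ≤ W ≤ log N`, `b < W`: `N ≤ X ≤ 2 N LN`, `LN ≤ L ≤ 2 LN`. [folklore] -/
theorem size_facts {W b N : ℕ} (hW : 0 < W) (hb : b < W) (hN4 : 4 ≤ Real.log N)
    (hWle : (W : ℝ) ≤ Real.log N) :
    (N : ℝ) ≤ ((W * N + b : ℕ) : ℝ) ∧ ((W * N + b : ℕ) : ℝ) ≤ 2 * N * Real.log N ∧
      Real.log N ≤ Real.log ((W * N + b : ℕ) : ℝ) ∧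
      Real.log ((W * N + b : ℕ) : ℝ) ≤ 2 * Real.log N := by
  have hN16 := sixteen_le_of_log hN4
  have hN0 : (0 : ℝ) < N := by linarith
  have hW1 : (1 : ℝ) ≤ W := by exact_mod_cast hW
  have hbW : (b : ℝ) ≤ W := by exact_mod_cast hb.le
  have hX : ((W * N + b : ℕ) : ℝ) = W * N + b := by push_cast; ring
  have h1 : (N : ℝ) ≤ ((W * N + b : ℕ) : ℝ) := by
    rw [hX]; nlinarith [Nat.cast_nonneg (α := ℝ) b]
  have h2 : ((W * N + b : ℕ) : ℝ) ≤ 2 * N * Real.log N := by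
    rw [hX]
    calc (W : ℝ) * N + b ≤ W * N + W * N := by nlinarith
      _ = 2 * N * W := by ring
      _ ≤ 2 * N * Real.log N := by gcongr
  have h3 : Real.log N ≤ Real.log ((W * N + b : ℕ) : ℝ) := Real.log_le_log hN0 h1
  have h4 : Real.log ((W * N + b : ℕ) : ℝ) ≤ 2 * Real.log N := by
    have h2L : 2 * Real.log N ≤ N := two_mul_log_le hN16
    have hXN2 : ((W * N + b : ℕ) : ℝ) ≤ (N : ℝ) ^ 2 := by nlinarith
    calc Real.log ((W * N + b : ℕ) : ℝ) ≤ Real.log ((N : ℝ) ^ 2) :=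
          Real.log_le_log (by linarith) hXN2
      _ = 2 * Real.log N := by rw [Real.log_pow]; norm_num
  exact ⟨h1, h2, h3, h4⟩

/-! ### The major-arc case -/

/-- If `q > 1` is coprime to `W = ∏_{p ≤ w} p` then all prime factors of `q` exceed `w`, so
`φ(q) ≥ w`. [folklore] -/
theorem le_totient_of_coprime_primorial {q w : ℕ} (hq : 1 < q) (hcop : q.Coprime (primorial w)) :
    w ≤ Nat.totient q := by
  set p := q.minFac with hp
  have hpp : p.Prime := Nat.minFac_prime hq.ne'
  have hpq : p ∣ q := Nat.minFac_dvd q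
  have hwp : w < p := by
    by_contra h
    push Not at h
    have h1 : p ∣ primorial w := (Nat.Prime.dvd_primorial_iff hpp).2 h
    have h2 : p ∣ Nat.gcd q (primorial w) := Nat.dvd_gcd hpq h1
    rw [hcop] at h2
    exact hpp.one_lt.ne' (Nat.dvd_one.1 h2)
  have h3 : Nat.totient p ≤ Nat.totient q :=
    Nat.le_of_dvd (Nat.totient_pos.2 (by omega)) (Nat.totient_dvd_of_dvd hpq)
  rw [Nat.totient_prime hpp] at h3
  omega

/-- **The major-arc case of the estimate.** With the Siegel–Walfisz package `SWBound 26 C₂`,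
`W = ∏_{p ≤ w} p ≤ log N`, `1 ≤ b < W`, `(b,W) = 1`, `4 ≤ log N`, `1 ≤ q ≤ L¹²`, `(a,q) = 1`,
`|β| N ≤ L¹²` (`L = log (WN + b)`):
`‖∑_{n ≤ N} (Λ'_{b,W}(n) − 1) e(n(a/q + β))‖ ≤ 2³⁰ C₂ N/log N + 2⁴⁶ √N (log N)³⁸ + N/w`.
[cite: GreenTao2010, §12 (case `s = 1`)] -/
theorem major_case {C₂ : ℝ} (hC₂ : 0 ≤ C₂) (hSW : SWBound 26 C₂) {W b q N w : ℕ} (hW : 0 < W)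
    (hb : b < W) (hb1 : 1 ≤ b) (hbW : b.Coprime W) (hWdef : W = primorial w) (hw : 0 < w)
    (hN4 : 4 ≤ Real.log N) (hWle : (W : ℝ) ≤ Real.log N) (hq : 1 ≤ q)
    (hqL : (q : ℝ) ≤ Real.log ((W * N + b : ℕ) : ℝ) ^ 12) {a : ℤ} (ha : IsCoprime a (q : ℤ))
    {β : ℝ} (hβ : |β| * N ≤ Real.log ((W * N + b : ℕ) : ℝ) ^ 12) :
    ‖∑ n ∈ Icc 1 N, ((vonMangoldtW W b n - 1 : ℝ) : ℂ) * (𝐞 ((n : ℝ) * ((a : ℝ) / q + β)) : ℂ)‖ ≤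
      2 ^ 30 * C₂ * N / Real.log N + 2 ^ 46 * Real.sqrt N * Real.log N ^ 38 + N / w := by
  obtain ⟨hXN, hX2N, hLNL, hL2⟩ := size_facts hW hb hN4 hWle
  set X : ℝ := ((W * N + b : ℕ) : ℝ) with hXdef
  set L : ℝ := Real.log X with hLdef
  set LN : ℝ := Real.log N with hLNdef
  have hN16 := sixteen_le_of_log hN4
  have hN1 : (1 : ℝ) ≤ N := by linarith
  have hLN1 : 1 ≤ LN := by linarith
  have hL4 : 4 ≤ L := hN4.trans hLNL
  have hL1 : 1 ≤ L := by linarith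
  have hL0 : 0 < L := by linarith
  have hX1 : 1 ≤ X := hN1.trans hXN
  have hX9 : (9 : ℝ) ≤ X := by linarith
  have hw0 : (0 : ℝ) < w := by exact_mod_cast hw
  have hq0 : (0 : ℝ) < q := by exact_mod_cast hq
  -- the side condition `qW ≤ (L/2)^26`
  have hqW : ((q * W : ℕ) : ℝ) ≤ (Real.log X / 2) ^ (26 : ℝ) := by
    rw [← hLdef, show (26 : ℝ) = ((26 : ℕ) : ℝ) by norm_num, Real.rpow_natCast]
    have h1 : ((q * W : ℕ) : ℝ) ≤ L ^ 13 := by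
      push_cast
      calc (q : ℝ) * W ≤ L ^ 12 * L := mul_le_mul hqL (hWle.trans hLNL) (by positivity) (by positivity)
        _ = L ^ 13 := by ring
    have h2 : L ^ 13 ≤ (L / 2) ^ 26 := by
      rw [div_pow]
      rw [le_div_iff₀ (by positivity)]
      have h4 : (4 : ℝ) ^ 13 ≤ L ^ 13 := pow_le_pow_left₀ (by norm_num) hL4 13
      have : L ^ 26 = L ^ 13 * L ^ 13 := by ring
      rw [this]
      have h5 : (2 : ℝ) ^ 26 = 4 ^ 13 := by norm_num
      rw [h5]
      exact mul_le_mul_of_nonneg_left h4 (by positivity)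
    exact h1.trans h2
  have hmain := norm_sum_vonMangoldtW_sub_one_majorArc_le (A₂ := 26) (by norm_num) hC₂ hSW hW hb
    hb1 hbW hq ha hX9 hqW β
  -- the error terms
  have hM : majorErr 26 C₂ X q W = 7 * Real.sqrt X + C₂ * 2 ^ 26 * X / L ^ 26 +
      2 * Real.sqrt X * L + Real.log ((q * W : ℕ) : ℝ) + 2 * q + 1 := by
    simp only [majorErr, ← hLdef]
    rw [show (26 : ℝ) = ((26 : ℕ) : ℝ) by norm_num, Real.rpow_natCast, Real.rpow_natCast]
  have hℓ0 : 0 ≤ Real.log ((q * W : ℕ) : ℝ) :=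
    Real.log_nonneg (by exact_mod_cast Nat.mul_pos hq hW)
  have hℓ : Real.log ((q * W : ℕ) : ℝ) ≤ L ^ 13 := by
    refine (Real.log_le_self (Nat.cast_nonneg _)).trans ?_
    push_cast
    calc (q : ℝ) * W ≤ L ^ 12 * L := mul_le_mul hqL (hWle.trans hLNL) (by positivity) (by positivity)
      _ = L ^ 13 := by ring
  have hT0 : 0 ≤ |β| * N := by positivity
  have hnum := major_numeric (T := |β| * N) (ℓ := Real.log ((q * W : ℕ) : ℝ)) hC₂ hLN1 hLNL hL2
    hX1 hX2N hN1 (by exact_mod_cast hq) hqL hT0 hβ hℓ0 hℓ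
  have hE : (q : ℝ) * majorErr 26 C₂ X q W * (1 + 2 * Real.pi * |β| * N) +
      (q : ℝ) ^ 2 * (1 + 2 * Real.pi * |β| * N) ≤ 2 ^ 30 * C₂ * N / LN + 2 ^ 45 * Real.sqrt N * LN ^ 38 := by
    rw [hM, show 2 * Real.pi * |β| * N = 2 * Real.pi * (|β| * N) by ring]
    exact hnum
  -- the main term
  have hpoly : (2 : ℝ) * q ≤ 2 ^ 13 * Real.sqrt N * LN ^ 38 := by
    have h1 : (q : ℝ) ≤ (2 * LN) ^ 12 := hqL.trans (pow_le_pow_left₀ hL0.le hL2 12)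
    have h2 : (2 * LN) ^ 12 = 2 ^ 12 * LN ^ 12 := by rw [mul_pow]
    have h3 : LN ^ 12 ≤ LN ^ 38 := pow_le_pow_right₀ hLN1 (by norm_num)
    have h4 : LN ^ 38 ≤ Real.sqrt N * LN ^ 38 :=
      le_mul_of_one_le_left (by positivity) (Real.one_le_sqrt.2 hN1)
    nlinarith
  have hmid : (if 1 < q ∧ q.Coprime W then ((N : ℝ) + 2 * q) / Nat.totient q else 0) ≤
      N / w + 2 ^ 13 * Real.sqrt N * LN ^ 38 := by
    split_ifs with h
    · have hφ : (w : ℝ) ≤ Nat.totient q := by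
        rw [hWdef] at h
        exact_mod_cast le_totient_of_coprime_primorial h.1 h.2
      calc ((N : ℝ) + 2 * q) / Nat.totient q ≤ ((N : ℝ) + 2 * q) / w :=
            div_le_div_of_nonneg_left (by positivity) hw0 hφ
        _ = N / w + 2 * q / w := by ring
        _ ≤ N / w + 2 * q := by
            have : 2 * (q : ℝ) / w ≤ 2 * q := div_le_self (by positivity) (by exact_mod_cast hw)
            linarith
        _ ≤ N / w + 2 ^ 13 * Real.sqrt N * LN ^ 38 := by linarith
    · positivity
  have hsN : 0 ≤ Real.sqrt N * LN ^ 38 := by positivity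
  calc _ ≤ _ := hmain
    _ ≤ 2 ^ 30 * C₂ * N / LN + 2 ^ 45 * Real.sqrt N * LN ^ 38 +
          (N / w + 2 ^ 13 * Real.sqrt N * LN ^ 38) := by linarith
    _ ≤ 2 ^ 30 * C₂ * N / LN + 2 ^ 46 * Real.sqrt N * LN ^ 38 + N / w := by nlinarith

/-! ### The minor-arc case -/

/-- **The minor-arc case of the estimate.** With Vinogradov's bound (constant `C ≥ 0`),
`W ≤ log N`, `b < W`, `4 ≤ log N`, `2¹² (log N)¹² ≤ N`, and `α` admitting NO approximation
`|α − a/q| ≤ L¹²/N` with `1 ≤ q ≤ L¹²`, `(a, q) = 1` (`L = log(WN + b)`):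
`‖∑_{n ≤ N} (Λ'_{b,W}(n) − 1) e(nα)‖ ≤ 4C N/log N + (32 C + 2) N^{4/5} (log N)⁵ + N/(2 log N)`
(Dirichlet's approximation theorem at each frequency `(α + j)/W`, Vinogradov's estimate there,
`norm_sum_vonMangoldtW_mul_le`, and `‖∑_{n ≤ N} e(nα)‖ ≤ 1/(2‖α‖) < N/(2L¹²)`).
[cite: GreenTao2010, §12 (case `s = 1`); Nathanson1996, Thm. 8.5] -/
theorem minor_case {C : ℝ} (hC : 0 ≤ C)
    (hV : ∀ (X : ℕ), 2 ≤ X → ∀ (θ : ℝ) (a : ℤ) (q : ℕ), 1 ≤ q → q ≤ X →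
      IsCoprime a (q : ℤ) → |θ - a / q| ≤ 1 / (q : ℝ) ^ 2 →
        ‖primeExpSumLog X θ‖ ≤
          C * ((X : ℝ) / Real.sqrt q + (X : ℝ) ^ (4 / 5 : ℝ) + Real.sqrt X * Real.sqrt q) *
            Real.log X ^ 4)
    {W b N : ℕ} (hW : 0 < W) (hb : b < W) (hN4 : 4 ≤ Real.log N) (hWle : (W : ℝ) ≤ Real.log N)
    (hbig : (2 : ℝ) ^ 12 * Real.log N ^ 12 ≤ N) {α : ℝ}
    (hmin : ¬ ∃ q : ℕ, 1 ≤ q ∧ (q : ℝ) ≤ Real.log ((W * N + b : ℕ) : ℝ) ^ 12 ∧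
        ∃ a : ℤ, IsCoprime a (q : ℤ) ∧ |α - a / q| * N ≤ Real.log ((W * N + b : ℕ) : ℝ) ^ 12) :
    ‖∑ n ∈ Icc 1 N, ((vonMangoldtW W b n - 1 : ℝ) : ℂ) * (𝐞 ((n : ℝ) * α) : ℂ)‖ ≤
      4 * C * N / Real.log N + (32 * C + 2) * (N : ℝ) ^ (4 / 5 : ℝ) * Real.log N ^ 5 +
        N / (2 * Real.log N) := by
  obtain ⟨hXN, hX2N, hLNL, hL2⟩ := size_facts hW hb hN4 hWle
  set Xn : ℕ := W * N + b with hXndef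
  set X : ℝ := ((W * N + b : ℕ) : ℝ) with hXdef
  have hXX : (Xn : ℝ) = X := by rw [hXndef, hXdef]
  set L : ℝ := Real.log X with hLdef
  set LN : ℝ := Real.log N with hLNdef
  have hN16 := sixteen_le_of_log hN4
  have hN1 : (1 : ℝ) ≤ N := by linarith
  have hN0 : (0 : ℝ) < N := by linarith
  have hLN1 : 1 ≤ LN := by linarith
  have hL4 : 4 ≤ L := hN4.trans hLNL
  have hL1 : 1 ≤ L := by linarith
  have hL0 : 0 < L := by linarith
  have hX1 : 1 ≤ X := hN1.trans hXN
  have hX0 : 0 < X := by linarith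
  have hW0 : (0 : ℝ) < W := by exact_mod_cast hW
  have hL12 : (1 : ℝ) ≤ L ^ 12 := one_le_pow₀ hL1
  -- `L¹² ≤ X`
  have hL12X : L ^ 12 ≤ X := by
    calc L ^ 12 ≤ (2 * LN) ^ 12 := pow_le_pow_left₀ hL0.le hL2 12
      _ = 2 ^ 12 * LN ^ 12 := by rw [mul_pow]
      _ ≤ N := hbig
      _ ≤ X := hXN
  -- (U): the linear exponential sum
  have hU : ‖∑ n ∈ Icc 1 N, (𝐞 ((n : ℝ) * α) : ℂ)‖ ≤ N / (2 * L ^ 12) := by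
    have hd : L ^ 12 / N < Vinogradov.distInt α := by
      by_contra h
      push Not at h
      refine hmin ⟨1, le_rfl, by simpa using hL12, round α, isCoprime_one_right, ?_⟩
      simp only [Nat.cast_one, div_one]
      have : |α - (round α : ℝ)| = Vinogradov.distInt α := rfl
      rw [this]
      calc Vinogradov.distInt α * N ≤ L ^ 12 / N * N := by gcongr
        _ = L ^ 12 := by field_simp
    have hd0 : 0 < Vinogradov.distInt α := lt_of_le_of_lt (by positivity) hd
    have h1 := norm_sum_Icc_fourierChar_mul_distInt_le N α
    rw [← le_div_iff₀ hd0] at h1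
    refine h1.trans ?_
    rw [div_le_div_iff₀ hd0 (by positivity)]
    have : L ^ 12 / N * (2 * L ^ 12)⁻¹ * (2 * L ^ 12) = L ^ 12 / N := by field_simp
    calc 1 / 2 * (2 * L ^ 12) = L ^ 12 / N * N := by field_simp
      _ ≤ N * Vinogradov.distInt α := by rw [mul_comm]; exact mul_le_mul_of_nonneg_left hd.le hN0.le
  -- (Λ): Vinogradov at each frequency `(α + j)/W`
  set Bv : ℝ := C * (X / L ^ 6 + X ^ (4 / 5 : ℝ) + X / L ^ 6) * L ^ 4 with hBv
  have hB : ∀ j ∈ range W, ‖primeExpSumLog (W * N + b) ((α + j) / W)‖ ≤ Bv := by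
    intro j _
    set θ : ℝ := (α + j) / W with hθ
    -- Dirichlet
    set Q₀ : ℕ := ⌊X / L ^ 12⌋₊ with hQ₀
    have hQ₀pos : 0 < Q₀ := by
      rw [hQ₀, Nat.floor_pos, le_div_iff₀ (by positivity), one_mul]
      exact hL12X
    obtain ⟨r, hr1, hr2⟩ := Real.exists_rat_abs_sub_le_and_den_le θ hQ₀pos
    have hden1 : 1 ≤ r.den := r.den_pos
    have hden1R : (1 : ℝ) ≤ r.den := by exact_mod_cast hden1
    have hQ₀1 : X / L ^ 12 < (Q₀ : ℝ) + 1 := Nat.lt_floor_add_one _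
    have hQ₀le : (Q₀ : ℝ) ≤ X / L ^ 12 := Nat.floor_le (by positivity)
    have hrdenQ : (r.den : ℝ) ≤ Q₀ := by exact_mod_cast hr2
    -- the denominator is large, for otherwise `α` would be on a major arc
    have hden : L ^ 12 < r.den := by
      by_contra h
      push Not at h
      set r' : ℚ := (W : ℚ) * r - (j : ℚ) with hr'
      refine hmin ⟨r'.den, r'.den_pos, ?_, r'.num, ?_, ?_⟩
      · have hdvd : r'.den ∣ r.den := by
          rw [hr', Rat.sub_natCast_den]
          have := Rat.mul_den_dvd (W : ℚ) r
          rwa [Rat.den_natCast, one_mul] at this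
        calc (r'.den : ℝ) ≤ r.den := by exact_mod_cast Nat.le_of_dvd r.den_pos hdvd
          _ ≤ L ^ 12 := h
      · exact Int.isCoprime_iff_nat_coprime.2 (by simpa using r'.reduced)
      · have hcast : ((r'.num : ℝ) / (r'.den : ℝ)) = ((r' : ℚ) : ℝ) := by
          rw [Rat.cast_def]
        have hcast' : ((r' : ℚ) : ℝ) = W * (r : ℝ) - j := by
          rw [hr']; push_cast; ring
        have hdiff : α - ((r' : ℚ) : ℝ) = W * (θ - r) := by
          rw [hcast', hθ]; field_simp; ring
        have hInt : ((r'.num : ℝ) / ((r'.den : ℕ) : ℝ)) = ((r' : ℚ) : ℝ) := hcast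
        rw [show ((r'.den : ℕ) : ℝ) = (r'.den : ℝ) from rfl] at hInt
        rw [show (r'.num : ℝ) / (r'.den : ℝ) = ((r' : ℚ) : ℝ) from hInt, hdiff, abs_mul,
          abs_of_pos hW0]
        -- `W |θ − r| N ≤ W N /((Q₀+1) den) ≤ W N L¹²/X ≤ L¹²`
        have h1 : |θ - r| ≤ 1 / (((Q₀ : ℝ) + 1) * r.den) := hr1
        have h2 : 1 / (((Q₀ : ℝ) + 1) * r.den) ≤ 1 / ((Q₀ : ℝ) + 1) := by
          apply div_le_div_of_nonneg_left zero_le_one (by positivity)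
          exact le_mul_of_one_le_right (by positivity) hden1R
        have h3 : 1 / ((Q₀ : ℝ) + 1) ≤ L ^ 12 / X := by
          rw [div_le_div_iff₀ (by positivity) hX0, one_mul]
          have := (div_lt_iff₀ (by positivity : (0 : ℝ) < L ^ 12)).1 hQ₀1
          linarith
        have hWNX : (W : ℝ) * N ≤ X := by
          rw [hXdef]; push_cast; linarith [Nat.cast_nonneg (α := ℝ) b]
        calc (W : ℝ) * |θ - r| * N ≤ W * (L ^ 12 / X) * N := by
              gcongr; exact h1.trans (h2.trans h3)
          _ = (W * N) * L ^ 12 / X := by ring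
          _ ≤ X * L ^ 12 / X := by gcongr
          _ = L ^ 12 := by field_simp
    -- Vinogradov
    have hX2 : 2 ≤ Xn := by
      have : (2 : ℝ) ≤ (Xn : ℝ) := by rw [hXX]; linarith
      exact_mod_cast this
    have hdenX : r.den ≤ Xn := by
      have : (r.den : ℝ) ≤ Xn := by
        rw [hXX]
        calc (r.den : ℝ) ≤ Q₀ := hrdenQ
          _ ≤ X / L ^ 12 := hQ₀le
          _ ≤ X := div_le_self hX0.le hL12
      exact_mod_cast this
    have hcop : IsCoprime r.num (r.den : ℤ) :=
      Int.isCoprime_iff_nat_coprime.2 (by simpa using r.reduced)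
    have happrox : |θ - r.num / r.den| ≤ 1 / (r.den : ℝ) ^ 2 := by
      have hc : ((r.num : ℝ) / (r.den : ℝ)) = ((r : ℚ) : ℝ) := by rw [Rat.cast_def]
      rw [hc]
      refine hr1.trans ?_
      apply div_le_div_of_nonneg_left zero_le_one (by positivity)
      rw [sq]
      exact mul_le_mul_of_nonneg_right (by linarith) (by positivity)
    have hVj := hV Xn hX2 θ r.num r.den hden1 hdenX hcop happrox
    rw [hXX] at hVj
    refine hVj.trans ?_
    rw [hBv, ← hLdef]
    have hL6 : Real.sqrt (L ^ 12) = L ^ 6 := by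
      rw [show L ^ 12 = (L ^ 6) ^ 2 by ring, Real.sqrt_sq (by positivity)]
    have hsd : L ^ 6 ≤ Real.sqrt r.den := by
      rw [← hL6]; exact Real.sqrt_le_sqrt hden.le
    have ht1 : X / Real.sqrt r.den ≤ X / L ^ 6 :=
      div_le_div_of_nonneg_left hX0.le (by positivity) hsd
    have ht3 : Real.sqrt X * Real.sqrt r.den ≤ X / L ^ 6 := by
      have h1 : Real.sqrt (r.den : ℝ) ≤ Real.sqrt (X / L ^ 12) :=
        Real.sqrt_le_sqrt (hrdenQ.trans hQ₀le)
      have h2 : Real.sqrt (X / L ^ 12) = Real.sqrt X / L ^ 6 := by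
        rw [Real.sqrt_div' X (by positivity), hL6]
      calc Real.sqrt X * Real.sqrt r.den ≤ Real.sqrt X * (Real.sqrt X / L ^ 6) := by
            rw [← h2]; gcongr
        _ = X / L ^ 6 := by rw [mul_div_assoc', Real.mul_self_sqrt hX0.le]
    have hL40 : 0 ≤ L ^ 4 := by positivity
    gcongr
  have hΛ := norm_sum_vonMangoldtW_mul_le hW hb α hB
  -- combine
  have hsplit : ∑ n ∈ Icc 1 N, ((vonMangoldtW W b n - 1 : ℝ) : ℂ) * (𝐞 ((n : ℝ) * α) : ℂ) =
      ∑ n ∈ Icc 1 N, (vonMangoldtW W b n : ℂ) * (𝐞 ((n : ℝ) * α) : ℂ) -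
        ∑ n ∈ Icc 1 N, (𝐞 ((n : ℝ) * α) : ℂ) := by
    rw [← Finset.sum_sub_distrib]
    refine Finset.sum_congr rfl fun n _ => ?_
    push_cast; ring
  rw [hsplit]
  have hbLN : (b : ℝ) ≤ LN := (show (b : ℝ) ≤ W by exact_mod_cast hb.le).trans hWle
  have hnum := minor_numeric (b' := (b : ℝ)) hC hLN1 hLNL hL2 hX0.le hX2N hN1 (Nat.cast_nonneg b) hbLN
  have hUL : (N : ℝ) / (2 * L ^ 12) ≤ N / (2 * LN) := by
    apply div_le_div_of_nonneg_left hN0.le (by positivity)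
    have : LN ≤ L ^ 12 := hLNL.trans (le_self_pow₀ hL1 (by norm_num))
    linarith
  calc ‖∑ n ∈ Icc 1 N, (vonMangoldtW W b n : ℂ) * (𝐞 ((n : ℝ) * α) : ℂ) -
        ∑ n ∈ Icc 1 N, (𝐞 ((n : ℝ) * α) : ℂ)‖
      ≤ ‖∑ n ∈ Icc 1 N, (vonMangoldtW W b n : ℂ) * (𝐞 ((n : ℝ) * α) : ℂ)‖ +
          ‖∑ n ∈ Icc 1 N, (𝐞 ((n : ℝ) * α) : ℂ)‖ := norm_sub_le _ _
    _ ≤ (Bv + Real.log 4 * b) + N / (2 * L ^ 12) := add_le_add hΛ hU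
    _ ≤ 4 * C * N / LN + (32 * C + 2) * (N : ℝ) ^ (4 / 5 : ℝ) * LN ^ 5 + N / (2 * LN) :=
        add_le_add hnum hUL



/-! ### Assembly -/

/-- **Uniform exponential-sum estimate for the `W`-tricked primes** (Green–Tao 2010, Thm. 7.2 at
level `s = 1`, in exponential-sum form; unconditional). For every `ε > 0` there are `w₀, N₀` such
that for `N ≥ N₀`, `w₀ ≤ w ≤ ½ log log N`, `W = ∏_{p ≤ w} p`, `b ∈ [W]` coprime to `W` and every
real `α`:

  `‖∑_{n ≤ N} (Λ'_{b,W}(n) − 1) e(nα)‖ ≤ ε N`.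

Proof: the Hardy–Littlewood method (GT2010 §12, first paragraph: "the case `s = 1` of the
`W`-tricked Gowers norm estimate can be obtained by the classical Hardy–Littlewood method"):
major arcs by the Siegel–Walfisz theorem of the tree
(`Literature.NumberTheory.LFunctions.siegel_walfisz_holds`, through `major_case`), minor arcs by
Vinogradov's estimate of the tree (`Vinogradov.vinogradov_primeExpSumLog_bound`, through
`minor_case`), with `w₀ = ⌈4/ε⌉ + 2` (the only genuinely `w`-dependent term is the main term
`N/φ(q) ≤ N/w` at moduli `q > 1` coprime to `W`) and `N₀` ineffective (Siegel).
[cite: GreenTao2010, Thm. 7.2 and §12 (case `s = 1`)] -/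
theorem wtrick_expSum_estimate (ε : ℝ) (hε : 0 < ε) :
    ∃ w₀ N₀ : ℕ, ∀ N : ℕ, N₀ ≤ N → ∀ w : ℕ, w₀ ≤ w → (w : ℝ) ≤ Real.log (Real.log N) / 2 →
      ∀ b : ℕ, 1 ≤ b → b ≤ primorial w → Nat.Coprime b (primorial w) → ∀ α : ℝ,
        ‖∑ n ∈ Icc 1 N, ((vonMangoldtW (primorial w) b n - 1 : ℝ) : ℂ) * (𝐞 ((n : ℝ) * α) : ℂ)‖ ≤
          ε * N := by
  classical
  -- the two analytic inputs of the tree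
  obtain ⟨C₂, hC₂, hSW⟩ := swBound_of_siegel_walfisz
    Literature.NumberTheory.LFunctions.siegel_walfisz_holds (A₂ := 26) (by norm_num)
  obtain ⟨C₀, hV₀⟩ := Vinogradov.vinogradov_primeExpSumLog_bound
  set C : ℝ := max C₀ 0 with hCdef
  have hC : 0 ≤ C := le_max_right _ _
  have hV : ∀ (X : ℕ), 2 ≤ X → ∀ (θ : ℝ) (a : ℤ) (q : ℕ), 1 ≤ q → q ≤ X →
      IsCoprime a (q : ℤ) → |θ - a / q| ≤ 1 / (q : ℝ) ^ 2 →
        ‖primeExpSumLog X θ‖ ≤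
          C * ((X : ℝ) / Real.sqrt q + (X : ℝ) ^ (4 / 5 : ℝ) + Real.sqrt X * Real.sqrt q) *
            Real.log X ^ 4 := by
    intro X hX θ a q hq hqX hcop happ
    refine (hV₀ X hX θ a q hq hqX hcop happ).trans ?_
    have hX1 : (1 : ℝ) ≤ X := by exact_mod_cast (le_trans (by norm_num) hX)
    have h0 : 0 ≤ ((X : ℝ) / Real.sqrt q + (X : ℝ) ^ (4 / 5 : ℝ) + Real.sqrt X * Real.sqrt q) *
        Real.log X ^ 4 := by
      have : 0 ≤ (X : ℝ) ^ (4 / 5 : ℝ) := Real.rpow_nonneg (by linarith) _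
      have : 0 ≤ Real.log X := Real.log_nonneg hX1
      positivity
    rw [mul_assoc, mul_assoc]
    exact mul_le_mul_of_nonneg_right (le_max_left _ _) h0
  -- the eventual side conditions
  have hε4 : 0 < ε / 4 := by positivity
  have e1 := eventually_nat_le_log (max 4 (max (2 ^ 32 * C₂ / ε) (max (16 * C / ε) (2 / ε))))
  have e2 := eventually_nat_mul_log_pow_mul_rpow_le (2 ^ 46) 38 (by norm_num : (1 / 2 : ℝ) < 1) hε4
  have e3 := eventually_nat_mul_log_pow_mul_rpow_le (32 * C + 2) 5 (by norm_num : (4 / 5 : ℝ) < 1) hε4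
  have e4 := eventually_nat_mul_log_pow_mul_rpow_le (2 ^ 12) 12 (by norm_num : (0 : ℝ) < 1)
    zero_lt_one
  obtain ⟨N₀, hN₀⟩ := eventually_atTop.1 (e1.and (e2.and (e3.and e4)))
  refine ⟨⌈4 / ε⌉₊ + 2, N₀, fun N hN w hw hwlog b hb1 hbW hcop α => ?_⟩
  obtain ⟨c1, c2, c3, c4⟩ := hN₀ N hN
  -- unpack the conditions
  have hN4 : 4 ≤ Real.log N := (le_max_left _ _).trans c1
  have hN16 := sixteen_le_of_log hN4
  have hN0 : (0 : ℝ) < N := by linarith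
  have hN1 : (1 : ℝ) ≤ N := by linarith
  have hLN0 : 0 < Real.log N := by linarith
  have cC₂ : 2 ^ 32 * C₂ / ε ≤ Real.log N := ((le_max_left _ _).trans (le_max_right _ _)).trans c1
  have cC : 16 * C / ε ≤ Real.log N :=
    (((le_max_left _ _).trans (le_max_right _ _)).trans (le_max_right _ _)).trans c1
  have cε : 2 / ε ≤ Real.log N :=
    (((le_max_right _ _).trans (le_max_right _ _)).trans (le_max_right _ _)).trans c1
  have hsqrt : Real.sqrt N = (N : ℝ) ^ (1 / 2 : ℝ) := Real.sqrt_eq_rpow N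
  have c2' : 2 ^ 46 * Real.sqrt N * Real.log N ^ 38 ≤ ε / 4 * N := by
    rw [hsqrt]; linarith [c2]
  have c3' : (32 * C + 2) * (N : ℝ) ^ (4 / 5 : ℝ) * Real.log N ^ 5 ≤ ε / 4 * N := by linarith [c3]
  have c4' : (2 : ℝ) ^ 12 * Real.log N ^ 12 ≤ N := by
    rw [Real.rpow_zero, mul_one, one_mul] at c4; exact c4
  -- the modulus `W`
  set W : ℕ := primorial w with hWdef
  have hw2 : 2 ≤ w := le_trans (by omega) hw
  have hW2 : 2 ≤ W := by
    have := primorial_mono hw2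
    rwa [primorial_two] at this
  have hW : 0 < W := by omega
  have hw0 : 0 < w := by omega
  have hb : b < W := by
    refine lt_of_le_of_ne hbW fun h => ?_
    rw [h, Nat.coprime_self] at hcop
    omega
  have hN3 : (3 : ℝ) ≤ N := by linarith
  have hWle : (W : ℝ) ≤ Real.log N := primorial_le_log hN3 hwlog
  -- `N/w ≤ ε N / 4`
  have hwε : 4 / ε ≤ (w : ℝ) := by
    have h1 : (4 / ε : ℝ) ≤ ⌈4 / ε⌉₊ := Nat.le_ceil _
    have h2 : ((⌈4 / ε⌉₊ : ℕ) : ℝ) ≤ w := by exact_mod_cast le_trans (Nat.le_add_right _ 2) hw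
    linarith
  have hw0R : (0 : ℝ) < w := by exact_mod_cast hw0
  have hNw : (N : ℝ) / w ≤ ε / 4 * N := by
    rw [div_le_iff₀ hw0R]
    have h1 : (N : ℝ) = ε / 4 * N * (4 / ε) := by field_simp
    calc (N : ℝ) = ε / 4 * N * (4 / ε) := h1
      _ ≤ ε / 4 * N * w := by gcongr
  -- `K N / log N ≤ ε N / 4`-type consequences
  have hdiv1 : 2 ^ 30 * C₂ * N / Real.log N ≤ ε / 4 * N := by
    rw [div_le_iff₀ hLN0]
    have h1 : 2 ^ 30 * C₂ ≤ ε / 4 * Real.log N := by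
      have := (div_le_iff₀ hε).1 cC₂; linarith
    calc 2 ^ 30 * C₂ * (N : ℝ) ≤ ε / 4 * Real.log N * N := mul_le_mul_of_nonneg_right h1 hN0.le
      _ = ε / 4 * N * Real.log N := by ring
  have hdiv2 : 4 * C * N / Real.log N ≤ ε / 4 * N := by
    rw [div_le_iff₀ hLN0]
    have h1 : 4 * C ≤ ε / 4 * Real.log N := by
      have := (div_le_iff₀ hε).1 cC; linarith
    calc 4 * C * (N : ℝ) ≤ ε / 4 * Real.log N * N := mul_le_mul_of_nonneg_right h1 hN0.le
      _ = ε / 4 * N * Real.log N := by ring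
  have hdiv3 : (N : ℝ) / (2 * Real.log N) ≤ ε / 4 * N := by
    rw [div_le_iff₀ (by positivity)]
    have h1 : (1 : ℝ) ≤ ε / 4 * (2 * Real.log N) := by
      have := (div_le_iff₀ hε).1 cε; linarith
    calc (N : ℝ) = 1 * N := (one_mul _).symm
      _ ≤ ε / 4 * (2 * Real.log N) * N := mul_le_mul_of_nonneg_right h1 hN0.le
      _ = ε / 4 * N * (2 * Real.log N) := by ring
  -- major / minor dichotomy
  by_cases hmaj : ∃ q : ℕ, 1 ≤ q ∧ (q : ℝ) ≤ Real.log ((W * N + b : ℕ) : ℝ) ^ 12 ∧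
      ∃ a : ℤ, IsCoprime a (q : ℤ) ∧ |α - a / q| * N ≤ Real.log ((W * N + b : ℕ) : ℝ) ^ 12
  · obtain ⟨q, hq1, hqL, a, ha, hβ⟩ := hmaj
    set β : ℝ := α - a / q with hβdef
    have hαβ : α = a / q + β := by rw [hβdef]; ring
    have hrw : ∑ n ∈ Icc 1 N, ((vonMangoldtW W b n - 1 : ℝ) : ℂ) * (𝐞 ((n : ℝ) * α) : ℂ) =
        ∑ n ∈ Icc 1 N, ((vonMangoldtW W b n - 1 : ℝ) : ℂ) * (𝐞 ((n : ℝ) * ((a : ℝ) / q + β)) : ℂ) := by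
      rw [← hαβ]
    rw [hrw]
    have h := major_case hC₂ hSW hW hb hb1 hcop hWdef hw0 hN4 hWle hq1 hqL ha hβ
    calc _ ≤ _ := h
      _ ≤ ε / 4 * N + ε / 4 * N + ε / 4 * N := add_le_add (add_le_add hdiv1 c2') hNw
      _ ≤ ε * N := by linarith [mul_pos hε hN0]
  · have h := minor_case hC hV hW hb hN4 hWle c4' hmaj
    calc _ ≤ _ := h
      _ ≤ ε / 4 * N + ε / 4 * N + ε / 4 * N := add_le_add (add_le_add hdiv2 c3') hdiv3
      _ ≤ ε * N := by linarith [mul_pos hε hN0]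

end WTrick

end Literature.NumberTheory.Sieve
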